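import Summits.QuantumFields.GaugeBoot.BootstrapValueContinuity
import Summits.QuantumFields.GaugeBoot.BootstrapCouplingJumpInstance
import HarnessLib

/-!
# `β = 0` is an exceptional coupling of the level-`n` bootstrap (gauge-boot, L1/L4 supplement)

HONEST FRAMING (cell `pub-gaugeboot`, page 1 of every file): the venture produces certified bounds
on lattice expectations at stated coupling, gauge group, dimension and torus size; NOT a mass gap,
NOT a continuum limit, NOT a string tension; NOT Yang–Mills-summit-bearing (barriers
`FixedCouplingUltralocality`, `PerturbativeInvisibility`). Structural; it certifies no number.

## Content

`BootstrapValueContinuity`: the level-`n` SDP bounds are continuous in `β` outside the finite set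
`exceptionalCouplings N n` of couplings where the loop-equation row space has non-maximal dimension.
`BootstrapCouplingJumpInstance`: an explicit objective whose level-`n` upper bound is discontinuous
at `β = 0`. Together:

* ★★ `zero_mem_exceptionalCouplings_suN` — `SU(N)`, `N ≥ 2`, level `n ≥ 4`, some `∂_{i,a}S ≠ 0`
  and `n` distinct links off the plaquettes of `i`: `0 ∈ exceptionalCouplings N n` — at `β = 0` the
  row space `{f' - β f S'}` has strictly less than its generic dimension (it collapses into `V_n`);
* `exceptionalCouplings_nonempty_suN` — so the exceptional set of `continuousAt_sSup_levelValues_suN`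
  is not empty in general: the finite-set proviso is necessary.

References: folklore.
-/

noncomputable section

open MeasureTheory Filter Topology
open Literature.MathematicalPhysics.QuantumFieldTheory (LatticeRep Site Edge GaugeConfig wilsonAction wilsonMeasure)
open Literature.MathematicalPhysics.QuantumLattice

namespace Summit.QuantumFields.GaugeBoot

section SuN

variable {d L : ℕ} [NeZero L] (N : ℕ)

/-- ★★ **`β = 0` is exceptional**: under the hypotheses of the unconditional jump
(`sSup_levelValues_prodEntry_jump_suN`), the dimension of the level-`n` row space at `β = 0` is not
maximal — otherwise the level-`n` upper bound of the explicit objective would be continuous at `0`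
(`continuousAt_levelValues_bounds_suN`), which it is not. [folklore] -/
theorem zero_mem_exceptionalCouplings_suN (hN : 2 ≤ N) (a₀ : Fin N) {n : ℕ} (hn : 4 ≤ n)
    {i : Edge d L} {a : SuGenerator N}
    (hS : torusActionDeriv (fundamentalLatticeRep N) (suExp N) i a ≠ 0)
    {e : ℕ → Edge d L} (he : Set.InjOn e (Set.Iio n)) (hei : ∀ m, m < n → e m ≠ i)
    (hfar : ∀ m, m < n → ∀ (x : Site d L) (j j' : Fin d), i ∈ plaqEdges x j j' → e m ∉ plaqEdges x j j') :
    (0 : ℝ) ∈ exceptionalCouplings (d := d) (L := L) N n := by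
  by_contra h0
  have hf := prod_reEntry_mem_wordSpace (fundamentalLatticeRep N) (T := e '' Set.Iio n) (e := e)
    (a₀ : Fin (fundamentalLatticeRep N).N) a₀ (n := n) fun m hm => ⟨m, hm, rfl⟩
  have hPn : (∏ m ∈ Finset.range n, reEntry (fundamentalLatticeRep N) (e m)
        (a₀ : Fin (fundamentalLatticeRep N).N) a₀) *
      torusActionDeriv (fundamentalLatticeRep N) (suExp N) i a ∈
        wordTruncation (ι := Edge d L) (fundamentalLatticeRep N) (n + 4) :=
    mul_torusActionDeriv_mem_wordTruncation_suN N i a hf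
  have hP : ∀ β : ℝ, (∏ m ∈ Finset.range n, reEntry (fundamentalLatticeRep N) (e m)
        (a₀ : Fin (fundamentalLatticeRep N).N) a₀) *
      torusActionDeriv (fundamentalLatticeRep N) (suExp N) i a ∈ certDomainSuN (d := d) (L := L) N β n :=
    fun β => mem_certDomainSuN_of_mem_wordTruncation N β (by omega) hPn
  have hcont := (continuousAt_levelValues_bounds_suN N hn h0 hP).1
  exact (not_continuousAt_zero_sSup_levelValues_prodEntry_suN N hN a₀ hn hS he hei hfar).2 hcont

/-- **The exceptional set is non-empty in general** (same hypotheses). -/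
theorem exceptionalCouplings_nonempty_suN (hN : 2 ≤ N) {n : ℕ} (hn : 4 ≤ n)
    {i : Edge d L} {a : SuGenerator N}
    (hS : torusActionDeriv (fundamentalLatticeRep N) (suExp N) i a ≠ 0)
    {e : ℕ → Edge d L} (he : Set.InjOn e (Set.Iio n)) (hei : ∀ m, m < n → e m ≠ i)
    (hfar : ∀ m, m < n → ∀ (x : Site d L) (j j' : Fin d), i ∈ plaqEdges x j j' → e m ∉ plaqEdges x j j') :
    (exceptionalCouplings (d := d) (L := L) N n).Nonempty :=
  ⟨0, zero_mem_exceptionalCouplings_suN N hN ⟨0, by omega⟩ hn hS he hei hfar⟩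

end SuN

end Summit.QuantumFields.GaugeBoot

end
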